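import Literature.Computability.MetaComplexity.BoundedArithDefinability
import HarnessLib

/-!
# Named-variable bounded formulas (`SForm`): a front end for writing `Σᵇ₁` definitions

Topic `Literature/Computability/MetaComplexity` (companion of `BoundedArithSyntax.lean`,
`BoundedArithRelabel.lean`, `BoundedArithDefinability.lean`).  The bootstrapping of Buss's `S₂¹`
(Buss 1986, Ch. 2) — on the way to "every polynomial-time function is `Σᵇ₁`-definable in `S₂¹`"
(`Literature/Computability/Complexity/BoundedArithmetic.lean`) — requires writing down *one explicit
`Σᵇ₁` formula* of Buss's language for each auxiliary notion (powers of two, division by `2ⁱ`,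
digits, computations, …) and knowing (a) that it lies in the class `Σᵇ₁` (or `Πᵇ₁`, or is sharply
bounded) and (b) what it means in an *arbitrary* structure.  Doing this directly on Mathlib's
de Bruijn-indexed `BoundedFormula` is error-prone; this file provides a small front end:

* `SForm n` — bounded formulas with *named* free variables `Fin n` and no other variables:
  atoms `t ≤ s`, `t = s` (`t s : Term (Fin n)`), `⊥`, the connectives `→, ∧, ∨`, and the four
  bounded quantifiers `∃xₙ ≤ t`, `∀xₙ ≤ t`, `∃xₙ ≤ |t|`, `∀xₙ ≤ |t|` binding the *new last*
  variable `Fin.last n` of a body in `SForm (n + 1)` (Buss 1986, §2.1);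
* `SForm.Realize φ v` — its meaning in a structure `M` under `v : Fin n → M`, by structural
  recursion (no quantifier bookkeeping: the body of `∃xₙ ≤ t` is evaluated at `Fin.snoc v a`);
* `SForm.toFormula : SForm n → Language.boundedArith.Formula (Fin n)` and
  **`SForm.realize_toFormula`**: `φ.toFormula.Realize v ↔ φ.Realize v`;
* `SForm.cls φ : Bool × Bool × Bool` — a structural check "(sharply bounded, `Σᵇ₁`, `Πᵇ₁`)"
  following the generating clauses of Buss's classes (Buss 1986, §2.1, Definition), and its
  soundness **`SForm.isSharplyBounded_toFormula` / `isSigmab_toFormula` / `isPib_toFormula`**;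
  for a concrete `φ` the certificate is `rfl`/`decide`-like, for schematic ones it is computed by
  `simp`;
* renaming of variables `SForm.rel`, substitution of terms `SForm.subst`, finite conjunctions and
  disjunctions `SForm.conj`, `SForm.disj`, with their `Realize` and `cls` lemmas;
* the bridge to definability *with parameters* in a fixed structure
  (`BoundedArithDefinability.lean`): assigning each named variable either a parameter from `M` or
  an argument, a `Σᵇ₁` (`Πᵇ₁`, sharply bounded) `SForm` defines an `IsSigmabDef 1`
  (`IsPibDef 1`, `IsSigmabDef 0`) predicate (`SForm.isSigmabDef`, `SForm.isPibDef`,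
  `SForm.isSigmabDef_zero`), to which the induction principles of `S₂¹` apply.

## References

* S. R. Buss, *Bounded Arithmetic*, Bibliopolis 1986, §2.1 (bounded quantifiers, the classes
  `Σᵇᵢ`, `Πᵇᵢ`; closure under renaming of variables and term substitution).
* J. Krajíček, *Bounded Arithmetic, Propositional Logic and Complexity Theory*, CUP 1995, §5.2.

## Design choices

* Only level `1` of the hierarchy (and sharply bounded formulas) is tracked by `cls`: this is all
  the `S₂¹` bootstrapping needs.
* `toFormula` binds the last named variable by relabelling it into the single in-context slot
  (`lastToBound`), exactly as `IsSigmabDef.bexLE` does in `BoundedArithDefinability.lean`.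
* Semantics use the instance-free operations `MLe`, `mLen` of `BoundedArithModels.lean`; in a
  model of `BASIC` they are rewritten to `≤`, `+`, … by the `simp` lemmas of
  `BoundedArithAlgebra.lean`.
-/

namespace Literature.Computability.MetaComplexity

open FirstOrder FirstOrder.Language

/-! ## Syntax -/

/-- **Named-variable bounded formulas** over Buss's language with free variables `Fin n`:
atoms `t ≤ s`, `t = s`, falsum, `→`, `∧`, `∨`, and the bounded quantifiers `∃xₙ ≤ t`, `∀xₙ ≤ t`,
`∃xₙ ≤ |t|`, `∀xₙ ≤ |t|` whose body has the extra free variable `Fin.last n` (Buss 1986, §2.1).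
[cite: Buss1986, §2.1] -/
inductive SForm : ℕ → Type
  /-- `t ≤ s` -/
  | le {n : ℕ} (t s : Language.boundedArith.Term (Fin n)) : SForm n
  /-- `t = s` -/
  | eq {n : ℕ} (t s : Language.boundedArith.Term (Fin n)) : SForm n
  /-- `⊥` -/
  | fls {n : ℕ} : SForm n
  /-- `φ → ψ` -/
  | imp {n : ℕ} (φ ψ : SForm n) : SForm n
  /-- `φ ∧ ψ` -/
  | and {n : ℕ} (φ ψ : SForm n) : SForm n
  /-- `φ ∨ ψ` -/
  | or {n : ℕ} (φ ψ : SForm n) : SForm n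
  /-- `∃ xₙ ≤ t, φ` -/
  | bex {n : ℕ} (t : Language.boundedArith.Term (Fin n)) (φ : SForm (n + 1)) : SForm n
  /-- `∀ xₙ ≤ t, φ` -/
  | ball {n : ℕ} (t : Language.boundedArith.Term (Fin n)) (φ : SForm (n + 1)) : SForm n
  /-- `∃ xₙ ≤ |t|, φ` -/
  | bexLen {n : ℕ} (t : Language.boundedArith.Term (Fin n)) (φ : SForm (n + 1)) : SForm n
  /-- `∀ xₙ ≤ |t|, φ` -/
  | ballLen {n : ℕ} (t : Language.boundedArith.Term (Fin n)) (φ : SForm (n + 1)) : SForm n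

namespace SForm

variable {n m : ℕ}

/-- `¬φ := φ → ⊥`. [folklore] -/
protected def not (φ : SForm n) : SForm n := imp φ fls

/-- `⊤ := ⊥ → ⊥`. [folklore] -/
def tru : SForm n := imp fls fls

/-- `φ ↔ ψ := (φ → ψ) ∧ (ψ → φ)`. [folklore] -/
protected def iff (φ ψ : SForm n) : SForm n := and (imp φ ψ) (imp ψ φ)

/-- `t < s := ¬(s ≤ t)` (in a linearly ordered structure). [folklore] -/
def lt (t s : Language.boundedArith.Term (Fin n)) : SForm n := SForm.not (le s t)

/-- `t ≠ s`. [folklore] -/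
def ne (t s : Language.boundedArith.Term (Fin n)) : SForm n := SForm.not (eq t s)

/-- Finite conjunction of a list of formulas. [folklore] -/
def conj : List (SForm n) → SForm n
  | [] => tru
  | φ :: l => and φ (conj l)

/-- Finite disjunction of a list of formulas. [folklore] -/
def disj : List (SForm n) → SForm n
  | [] => fls
  | φ :: l => or φ (disj l)

/-! ## Semantics -/

section Semantics

variable {M : Type} [Language.boundedArith.Structure M]

/-- The meaning of a named-variable bounded formula in a structure `M` under an assignment
`v : Fin n → M` of its free variables (instance-free: `≤` is `MLe`, `|·|` is `mLen`)
(Buss 1986, §2.1). [cite: Buss1986, §2.1] -/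
def Realize : {n : ℕ} → SForm n → (Fin n → M) → Prop
  | _, le t s, v => MLe (t.realize v) (s.realize v)
  | _, eq t s, v => t.realize v = s.realize v
  | _, fls, _ => False
  | _, imp φ ψ, v => Realize φ v → Realize ψ v
  | _, and φ ψ, v => Realize φ v ∧ Realize ψ v
  | _, or φ ψ, v => Realize φ v ∨ Realize ψ v
  | _, bex t φ, v => ∃ a, MLe a (t.realize v) ∧ Realize φ (Fin.snoc v a)
  | _, ball t φ, v => ∀ a, MLe a (t.realize v) → Realize φ (Fin.snoc v a)
  | _, bexLen t φ, v => ∃ a, MLe a (mLen (t.realize v)) ∧ Realize φ (Fin.snoc v a)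
  | _, ballLen t φ, v => ∀ a, MLe a (mLen (t.realize v)) → Realize φ (Fin.snoc v a)

variable (v : Fin n → M)

/-- Semantics of `≤`. [folklore] -/
@[simp] theorem realize_le (t s : Language.boundedArith.Term (Fin n)) :
    (le t s).Realize v ↔ MLe (t.realize v) (s.realize v) := Iff.rfl

/-- Semantics of `=`. [folklore] -/
@[simp] theorem realize_eq (t s : Language.boundedArith.Term (Fin n)) :
    (eq t s).Realize v ↔ t.realize v = s.realize v := Iff.rfl

/-- Semantics of `⊥`. [folklore] -/
@[simp] theorem realize_fls : (fls : SForm n).Realize v ↔ False := Iff.rfl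

/-- Semantics of `→`. [folklore] -/
@[simp] theorem realize_imp (φ ψ : SForm n) :
    (imp φ ψ).Realize v ↔ (φ.Realize v → ψ.Realize v) := Iff.rfl

/-- Semantics of `∧`. [folklore] -/
@[simp] theorem realize_and (φ ψ : SForm n) :
    (and φ ψ).Realize v ↔ (φ.Realize v ∧ ψ.Realize v) := Iff.rfl

/-- Semantics of `∨`. [folklore] -/
@[simp] theorem realize_or (φ ψ : SForm n) :
    (or φ ψ).Realize v ↔ (φ.Realize v ∨ ψ.Realize v) := Iff.rfl

/-- Semantics of `∃ xₙ ≤ t`. [folklore] -/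
@[simp] theorem realize_bex (t : Language.boundedArith.Term (Fin n)) (φ : SForm (n + 1)) :
    (bex t φ).Realize v ↔ ∃ a, MLe a (t.realize v) ∧ φ.Realize (Fin.snoc v a) := Iff.rfl

/-- Semantics of `∀ xₙ ≤ t`. [folklore] -/
@[simp] theorem realize_ball (t : Language.boundedArith.Term (Fin n)) (φ : SForm (n + 1)) :
    (ball t φ).Realize v ↔ ∀ a, MLe a (t.realize v) → φ.Realize (Fin.snoc v a) := Iff.rfl

/-- Semantics of `∃ xₙ ≤ |t|`. [folklore] -/
@[simp] theorem realize_bexLen (t : Language.boundedArith.Term (Fin n)) (φ : SForm (n + 1)) :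
    (bexLen t φ).Realize v ↔ ∃ a, MLe a (mLen (t.realize v)) ∧ φ.Realize (Fin.snoc v a) :=
  Iff.rfl

/-- Semantics of `∀ xₙ ≤ |t|`. [folklore] -/
@[simp] theorem realize_ballLen (t : Language.boundedArith.Term (Fin n)) (φ : SForm (n + 1)) :
    (ballLen t φ).Realize v ↔ ∀ a, MLe a (mLen (t.realize v)) → φ.Realize (Fin.snoc v a) :=
  Iff.rfl

/-- Semantics of `¬`. [folklore] -/
@[simp] theorem realize_not (φ : SForm n) : (SForm.not φ).Realize v ↔ ¬φ.Realize v := Iff.rfl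

/-- Semantics of `⊤`. [folklore] -/
@[simp] theorem realize_tru : (tru : SForm n).Realize v ↔ True := by
  simp [tru]

/-- Semantics of `↔`. [folklore] -/
@[simp] theorem realize_iff (φ ψ : SForm n) :
    (SForm.iff φ ψ).Realize v ↔ (φ.Realize v ↔ ψ.Realize v) := by
  simp only [SForm.iff, realize_and, realize_imp]
  exact iff_def.symm

/-- Semantics of `<` (as `¬ s ≤ t`). [folklore] -/
@[simp] theorem realize_lt (t s : Language.boundedArith.Term (Fin n)) :
    (lt t s).Realize v ↔ ¬MLe (s.realize v) (t.realize v) := Iff.rfl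

/-- Semantics of `≠`. [folklore] -/
@[simp] theorem realize_ne (t s : Language.boundedArith.Term (Fin n)) :
    (ne t s).Realize v ↔ t.realize v ≠ s.realize v := Iff.rfl

/-- Semantics of a finite conjunction. [folklore] -/
@[simp] theorem realize_conj (l : List (SForm n)) :
    (conj l).Realize v ↔ ∀ φ ∈ l, φ.Realize v := by
  induction l with
  | nil => simp [conj]
  | cons φ l ih => simp [conj, ih]

/-- Semantics of a finite disjunction. [folklore] -/
@[simp] theorem realize_disj (l : List (SForm n)) :
    (disj l).Realize v ↔ ∃ φ ∈ l, φ.Realize v := by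
  induction l with
  | nil => simp [disj]
  | cons φ l ih => simp [disj, ih]

end Semantics

/-! ## Translation to Mathlib formulas -/

/-- The relabelling moving the last named variable `Fin.last n` into the single bound slot and
keeping the others free. [folklore] -/
def lastToBound (n : ℕ) : Fin (n + 1) → Fin n ⊕ Fin 1 :=
  Fin.lastCases (Sum.inr 0) fun j => Sum.inl j

/-- **Translation** of a named-variable bounded formula into a Mathlib first-order formula of
Buss's language with free variables `Fin n`; bounded quantifiers become `bexLE`/`ballLE`/
`bexLELen`/`ballLELen` of `BoundedArithSyntax.lean` (Buss 1986, §2.1). [cite: Buss1986, §2.1] -/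
def toFormula : {n : ℕ} → SForm n → Language.boundedArith.Formula (Fin n)
  | _, le t s => Term.le (t.relabel Sum.inl) (s.relabel Sum.inl)
  | _, eq t s => Term.bdEqual (t.relabel Sum.inl) (s.relabel Sum.inl)
  | _, fls => ⊥
  | _, imp φ ψ => φ.toFormula ⟹ ψ.toFormula
  | _, and φ ψ => φ.toFormula ⊓ ψ.toFormula
  | _, or φ ψ => φ.toFormula ⊔ ψ.toFormula
  | n, bex t φ => bexLE (t.relabel Sum.inl) (BoundedFormula.relabel (lastToBound n) (toFormula φ))
  | n, ball t φ => ballLE (t.relabel Sum.inl) (BoundedFormula.relabel (lastToBound n) (toFormula φ))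
  | n, bexLen t φ => bexLELen (t.relabel Sum.inl) (BoundedFormula.relabel (lastToBound n) (toFormula φ))
  | n, ballLen t φ => ballLELen (t.relabel Sum.inl) (BoundedFormula.relabel (lastToBound n) (toFormula φ))

section ToFormula

variable {M : Type} [Language.boundedArith.Structure M]

omit [Language.boundedArith.Structure M] in
/-- The assignment seen by the body of a translated bounded quantifier. [folklore] -/
theorem elim_comp_lastToBound (v : Fin n → M) (y : Fin (1 + 0) → M) :
    Sum.elim v (y ∘ Fin.castAdd 0) ∘ lastToBound n = Fin.snoc v (y 0) := by
  funext j
  cases j using Fin.lastCases with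
  | last => simp [lastToBound]
  | cast j => simp [lastToBound]

/-- Semantics of the relabelled body of a translated bounded quantifier. [folklore] -/
theorem realize_relabel_lastToBound (ψ : Language.boundedArith.Formula (Fin (n + 1)))
    (v : Fin n → M) (a : M) :
    (BoundedFormula.relabel (lastToBound n) ψ).Realize v (Fin.snoc (default : Fin 0 → M) a) ↔
      ψ.Realize (Fin.snoc v a) := by
  rw [BoundedFormula.realize_relabel, elim_comp_lastToBound]
  have h0 : (Fin.snoc (default : Fin 0 → M) a : Fin 1 → M) 0 = a := Fin.snoc_last _ _
  simp only [Formula.Realize, h0]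
  exact Iff.of_eq (congrArg _ (Subsingleton.elim _ _))

/-- A term in the free variables, weakened into a context with bound variables, has the same
value. [folklore] -/
theorem realize_term_relabel_inl {k : ℕ} (t : Language.boundedArith.Term (Fin n)) (v : Fin n → M)
    (xs : Fin k → M) : (t.relabel Sum.inl).realize (Sum.elim v xs) = t.realize v := by
  rw [Term.realize_relabel, Sum.elim_comp_inl]

/-- **The translation is faithful**: `φ.toFormula` holds under `v` iff `φ.Realize v`
(Buss 1986, §2.1). [cite: Buss1986, §2.1] -/
theorem realize_toFormula : ∀ {n : ℕ} (φ : SForm n) (v : Fin n → M),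
    φ.toFormula.Realize v ↔ φ.Realize v
  | _, le t s, v => by
    simp only [toFormula, Formula.Realize, realize_le', realize_term_relabel_inl, realize_le]
  | _, eq t s, v => by
    simp only [toFormula, Formula.Realize, BoundedFormula.realize_bdEqual,
      realize_term_relabel_inl, realize_eq]
  | _, fls, v => Iff.rfl
  | _, imp φ ψ, v => by
    change φ.toFormula.Realize v → ψ.toFormula.Realize v ↔ _
    rw [realize_toFormula φ v, realize_toFormula ψ v, realize_imp]
  | _, and φ ψ, v => by
    change (φ.toFormula ⊓ ψ.toFormula).Realize v ↔ _
    rw [Formula.realize_inf, realize_toFormula φ v, realize_toFormula ψ v, realize_and]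
  | _, or φ ψ, v => by
    change (φ.toFormula ⊔ ψ.toFormula).Realize v ↔ _
    rw [Formula.realize_sup, realize_toFormula φ v, realize_toFormula ψ v, realize_or]
  | n, bex t φ, v => by
    change BoundedFormula.Realize (bexLE _ _) v default ↔ _
    rw [realize_bexLE', realize_term_relabel_inl, realize_bex]
    refine exists_congr fun a => and_congr_right fun _ => ?_
    rw [realize_relabel_lastToBound, realize_toFormula φ]
  | n, ball t φ, v => by
    change BoundedFormula.Realize (ballLE _ _) v default ↔ _
    rw [realize_ballLE', realize_term_relabel_inl, realize_ball]
    refine forall_congr' fun a => imp_congr_right fun _ => ?_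
    rw [realize_relabel_lastToBound, realize_toFormula φ]
  | n, bexLen t φ, v => by
    change BoundedFormula.Realize (bexLE _ _) v default ↔ _
    rw [realize_bexLE', realize_term_len, realize_term_relabel_inl, realize_bexLen]
    refine exists_congr fun a => and_congr_right fun _ => ?_
    rw [realize_relabel_lastToBound, realize_toFormula φ]
  | n, ballLen t φ, v => by
    change BoundedFormula.Realize (ballLE _ _) v default ↔ _
    rw [realize_ballLE', realize_term_len, realize_term_relabel_inl, realize_ballLen]
    refine forall_congr' fun a => imp_congr_right fun _ => ?_
    rw [realize_relabel_lastToBound, realize_toFormula φ]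

end ToFormula

/-! ## The classes: a structural check and its soundness -/

/-- **Structural class check** `(sharply bounded, Σᵇ₁, Πᵇ₁)` following the generating clauses
of Buss's classes (Buss 1986, §2.1, Definition): atoms are all three; `→` is `Σᵇ₁` when the
antecedent is `Πᵇ₁` and the consequent `Σᵇ₁` (dually for `Πᵇ₁`); `∧`, `∨` componentwise;
`∃x ≤ t` keeps `Σᵇ₁` only, `∀x ≤ t` keeps `Πᵇ₁` only, and the sharply bounded quantifiers keep all
three. [cite: Buss1986, §2.1  Definition] -/
def cls : {n : ℕ} → SForm n → Bool × Bool × Bool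
  | _, le _ _ => (true, true, true)
  | _, eq _ _ => (true, true, true)
  | _, fls => (true, true, true)
  | _, imp φ ψ =>
      ((cls φ).1 && (cls ψ).1,
        ((cls φ).1 && (cls ψ).1) || ((cls φ).2.2 && (cls ψ).2.1),
        ((cls φ).1 && (cls ψ).1) || ((cls φ).2.1 && (cls ψ).2.2))
  | _, and φ ψ =>
      ((cls φ).1 && (cls ψ).1,
        ((cls φ).1 && (cls ψ).1) || ((cls φ).2.1 && (cls ψ).2.1),
        ((cls φ).1 && (cls ψ).1) || ((cls φ).2.2 && (cls ψ).2.2))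
  | _, or φ ψ =>
      ((cls φ).1 && (cls ψ).1,
        ((cls φ).1 && (cls ψ).1) || ((cls φ).2.1 && (cls ψ).2.1),
        ((cls φ).1 && (cls ψ).1) || ((cls φ).2.2 && (cls ψ).2.2))
  | _, bex _ φ => (false, (cls φ).1 || (cls φ).2.1, false)
  | _, ball _ φ => (false, false, (cls φ).1 || (cls φ).2.2)
  | _, bexLen _ φ => ((cls φ).1, (cls φ).1 || (cls φ).2.1, (cls φ).1 || (cls φ).2.2)
  | _, ballLen _ φ => ((cls φ).1, (cls φ).1 || (cls φ).2.1, (cls φ).1 || (cls φ).2.2)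

/-- `φ` is (syntactically) sharply bounded. [cite: Buss1986, §2.1] -/
abbrev IsSB (φ : SForm n) : Prop := (cls φ).1 = true

/-- `φ` is (syntactically) `Σᵇ₁`. [cite: Buss1986, §2.1] -/
abbrev IsSig (φ : SForm n) : Prop := (cls φ).2.1 = true

/-- `φ` is (syntactically) `Πᵇ₁`. [cite: Buss1986, §2.1] -/
abbrev IsPi (φ : SForm n) : Prop := (cls φ).2.2 = true

section Soundness

variable {α : Type} {k : ℕ}

/-- `Πᵇ₁` is closed under `∧` (Buss 1986, §2.1); on Mathlib syntax `φ ⊓ ψ = ∼(φ ⟹ ∼ψ)`.  (Local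
copy; the general statement `IsPib.inf` lives in
`Literature/Computability/Complexity/BoundedArithmeticConservation.lean`.) [cite: Buss1986, §2.1] -/
private theorem isPib_inf {φ ψ : Language.boundedArith.BoundedFormula α k} (hφ : IsPib 1 φ)
    (hψ : IsPib 1 ψ) : IsPib 1 (φ ⊓ ψ) :=
  (IsSigmab.imp hφ hψ.not).not

/-- `Πᵇ₁` is closed under `∨` (Buss 1986, §2.1); on Mathlib syntax `φ ⊔ ψ = ∼φ ⟹ ψ`.
[cite: Buss1986, §2.1] -/
private theorem isPib_sup {φ ψ : Language.boundedArith.BoundedFormula α k} (hφ : IsPib 1 φ)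
    (hψ : IsPib 1 ψ) : IsPib 1 (φ ⊔ ψ) :=
  IsPib.imp hφ.not hψ

/-- Sharply bounded formulas are closed under `∧` (Buss 1986, §2.1). [cite: Buss1986, §2.1] -/
private theorem isSharplyBounded_inf {φ ψ : Language.boundedArith.BoundedFormula α k}
    (hφ : IsSharplyBounded φ) (hψ : IsSharplyBounded ψ) : IsSharplyBounded (φ ⊓ ψ) :=
  (hφ.imp hψ.not).not

/-- Sharply bounded formulas are closed under `∨` (Buss 1986, §2.1). [cite: Buss1986, §2.1] -/
private theorem isSharplyBounded_sup {φ ψ : Language.boundedArith.BoundedFormula α k}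
    (hφ : IsSharplyBounded φ) (hψ : IsSharplyBounded ψ) : IsSharplyBounded (φ ⊔ ψ) :=
  hφ.not.imp hψ

/-- **Soundness of the structural class check** (all three components at once, by induction on
the formula): the components of `cls φ` certify that `φ.toFormula` is sharply bounded, resp.
`Σᵇ₁`, resp. `Πᵇ₁` in the sense of `BoundedArithSyntax.lean` (Buss 1986, §2.1, Definition).
[cite: Buss1986, §2.1  Definition] -/
theorem cls_sound : ∀ {n : ℕ} (φ : SForm n),
    ((cls φ).1 = true → IsSharplyBounded φ.toFormula) ∧
      ((cls φ).2.1 = true → IsSigmab 1 φ.toFormula) ∧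
        ((cls φ).2.2 = true → IsPib 1 φ.toFormula)
  | _, le t s =>
    have h : IsSharplyBounded (le t s).toFormula := .of_isQF (BoundedFormula.IsAtomic.rel _ _).isQF
    ⟨fun _ => h, fun _ => .of_isSharplyBounded h, fun _ => .of_isSharplyBounded h⟩
  | _, eq t s =>
    have h : IsSharplyBounded (eq t s).toFormula :=
      .of_isQF (BoundedFormula.IsAtomic.equal _ _).isQF
    ⟨fun _ => h, fun _ => .of_isSharplyBounded h, fun _ => .of_isSharplyBounded h⟩
  | _, fls =>
    ⟨fun _ => .falsum, fun _ => .of_isSharplyBounded .falsum, fun _ => .of_isSharplyBounded .falsum⟩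
  | _, imp φ ψ => by
    obtain ⟨h1, h2, h3⟩ := cls_sound φ
    obtain ⟨k1, k2, k3⟩ := cls_sound ψ
    refine ⟨fun h => ?_, fun h => ?_, fun h => ?_⟩
    · simp only [cls, Bool.and_eq_true] at h
      exact (h1 h.1).imp (k1 h.2)
    · simp only [cls, Bool.or_eq_true, Bool.and_eq_true] at h
      rcases h with h | h
      · exact .of_isSharplyBounded ((h1 h.1).imp (k1 h.2))
      · exact IsSigmab.imp (h3 h.1) (k2 h.2)
    · simp only [cls, Bool.or_eq_true, Bool.and_eq_true] at h
      rcases h with h | h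
      · exact .of_isSharplyBounded ((h1 h.1).imp (k1 h.2))
      · exact IsPib.imp (h2 h.1) (k3 h.2)
  | _, and φ ψ => by
    obtain ⟨h1, h2, h3⟩ := cls_sound φ
    obtain ⟨k1, k2, k3⟩ := cls_sound ψ
    refine ⟨fun h => ?_, fun h => ?_, fun h => ?_⟩
    · simp only [cls, Bool.and_eq_true] at h
      exact isSharplyBounded_inf (h1 h.1) (k1 h.2)
    · simp only [cls, Bool.or_eq_true, Bool.and_eq_true] at h
      rcases h with h | h
      · exact .of_isSharplyBounded (isSharplyBounded_inf (h1 h.1) (k1 h.2))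
      · exact (h2 h.1).inf (k2 h.2)
    · simp only [cls, Bool.or_eq_true, Bool.and_eq_true] at h
      rcases h with h | h
      · exact .of_isSharplyBounded (isSharplyBounded_inf (h1 h.1) (k1 h.2))
      · exact isPib_inf (h3 h.1) (k3 h.2)
  | _, or φ ψ => by
    obtain ⟨h1, h2, h3⟩ := cls_sound φ
    obtain ⟨k1, k2, k3⟩ := cls_sound ψ
    refine ⟨fun h => ?_, fun h => ?_, fun h => ?_⟩
    · simp only [cls, Bool.and_eq_true] at h
      exact isSharplyBounded_sup (h1 h.1) (k1 h.2)
    · simp only [cls, Bool.or_eq_true, Bool.and_eq_true] at h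
      rcases h with h | h
      · exact .of_isSharplyBounded (isSharplyBounded_sup (h1 h.1) (k1 h.2))
      · exact (h2 h.1).sup (k2 h.2)
    · simp only [cls, Bool.or_eq_true, Bool.and_eq_true] at h
      rcases h with h | h
      · exact .of_isSharplyBounded (isSharplyBounded_sup (h1 h.1) (k1 h.2))
      · exact isPib_sup (h3 h.1) (k3 h.2)
  | n, bex t φ => by
    obtain ⟨h1, h2, -⟩ := cls_sound φ
    refine ⟨fun h => ?_, fun h => ?_, fun h => ?_⟩
    · simp [cls] at h
    · simp only [cls, Bool.or_eq_true] at h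
      have hφ : IsSigmab 1 φ.toFormula := h.elim (fun h => .of_isSharplyBounded (h1 h)) h2
      exact .bexLE _ (hφ.relabel _)
    · simp [cls] at h
  | n, ball t φ => by
    obtain ⟨h1, -, h3⟩ := cls_sound φ
    refine ⟨fun h => ?_, fun h => ?_, fun h => ?_⟩
    · simp [cls] at h
    · simp [cls] at h
    · simp only [cls, Bool.or_eq_true] at h
      have hφ : IsPib 1 φ.toFormula := h.elim (fun h => .of_isSharplyBounded (h1 h)) h3
      exact .ballLE _ (hφ.relabel _)
  | n, bexLen t φ => by
    obtain ⟨h1, h2, h3⟩ := cls_sound φ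
    refine ⟨fun h => ?_, fun h => ?_, fun h => ?_⟩
    · exact .bexLELen _ ((h1 h).relabel _)
    · simp only [cls, Bool.or_eq_true] at h
      have hφ : IsSigmab 1 φ.toFormula := h.elim (fun h => .of_isSharplyBounded (h1 h)) h2
      exact .bexLE _ (hφ.relabel _)
    · simp only [cls, Bool.or_eq_true] at h
      have hφ : IsPib 1 φ.toFormula := h.elim (fun h => .of_isSharplyBounded (h1 h)) h3
      exact .bexLELen _ (hφ.relabel _)
  | n, ballLen t φ => by
    obtain ⟨h1, h2, h3⟩ := cls_sound φ
    refine ⟨fun h => ?_, fun h => ?_, fun h => ?_⟩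
    · exact .ballLELen _ ((h1 h).relabel _)
    · simp only [cls, Bool.or_eq_true] at h
      have hφ : IsSigmab 1 φ.toFormula := h.elim (fun h => .of_isSharplyBounded (h1 h)) h2
      exact .ballLELen _ (hφ.relabel _)
    · simp only [cls, Bool.or_eq_true] at h
      have hφ : IsPib 1 φ.toFormula := h.elim (fun h => .of_isSharplyBounded (h1 h)) h3
      exact .ballLE _ (hφ.relabel _)

/-- A syntactically sharply bounded `SForm` translates to a sharply bounded formula
(Buss 1986, §2.1). [cite: Buss1986, §2.1] -/
theorem isSharplyBounded_toFormula {φ : SForm n} (h : φ.IsSB) : IsSharplyBounded φ.toFormula :=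
  (cls_sound φ).1 h

/-- A syntactically `Σᵇ₁` `SForm` translates to a `Σᵇ₁` formula (Buss 1986, §2.1).
[cite: Buss1986, §2.1] -/
theorem isSigmab_toFormula {φ : SForm n} (h : φ.IsSig) : IsSigmab 1 φ.toFormula :=
  (cls_sound φ).2.1 h

/-- A syntactically `Πᵇ₁` `SForm` translates to a `Πᵇ₁` formula (Buss 1986, §2.1).
[cite: Buss1986, §2.1] -/
theorem isPib_toFormula {φ : SForm n} (h : φ.IsPi) : IsPib 1 φ.toFormula :=
  (cls_sound φ).2.2 h

/-- Sharply bounded implies `Σᵇ₁` for the structural check. [folklore] -/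
theorem IsSB.isSig {φ : SForm n} (h : φ.IsSB) : φ.IsSig := by
  cases φ <;> simp_all [IsSB, IsSig, cls]

/-- Sharply bounded implies `Πᵇ₁` for the structural check. [folklore] -/
theorem IsSB.isPi {φ : SForm n} (h : φ.IsSB) : φ.IsPi := by
  cases φ <;> simp_all [IsSB, IsPi, cls]

end Soundness

/-! ### Class lemmas for the derived connectives -/

section ClsLemmas

/-- `cls` of `¬φ`. [folklore] -/
@[simp] theorem cls_not (φ : SForm n) :
    cls (SForm.not φ) = ((cls φ).1, (cls φ).1 || (cls φ).2.2, (cls φ).1 || (cls φ).2.1) := by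
  simp [SForm.not, cls]

/-- `cls` of `⊤`. [folklore] -/
@[simp] theorem cls_tru : cls (tru : SForm n) = (true, true, true) := by simp [tru, cls]

/-- `cls` of `<`. [folklore] -/
@[simp] theorem cls_lt (t s : Language.boundedArith.Term (Fin n)) :
    cls (lt t s) = (true, true, true) := by simp [lt, cls]

/-- `cls` of `≠`. [folklore] -/
@[simp] theorem cls_ne (t s : Language.boundedArith.Term (Fin n)) :
    cls (ne t s) = (true, true, true) := by simp [ne, cls]

/-- A conjunction of sharply bounded formulas is sharply bounded. [folklore] -/
theorem isSB_conj {l : List (SForm n)} (h : ∀ φ ∈ l, φ.IsSB) : (conj l).IsSB := by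
  induction l with
  | nil => simp [conj, IsSB]
  | cons φ l ih =>
    simp only [List.mem_cons, forall_eq_or_imp] at h
    have := ih h.2
    simp_all [conj, IsSB, cls]

/-- A conjunction of `Σᵇ₁` formulas is `Σᵇ₁`. [folklore] -/
theorem isSig_conj {l : List (SForm n)} (h : ∀ φ ∈ l, φ.IsSig) : (conj l).IsSig := by
  induction l with
  | nil => simp [conj, IsSig]
  | cons φ l ih =>
    simp only [List.mem_cons, forall_eq_or_imp] at h
    have := ih h.2
    simp_all [conj, IsSig, cls]

/-- A conjunction of `Πᵇ₁` formulas is `Πᵇ₁`. [folklore] -/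
theorem isPi_conj {l : List (SForm n)} (h : ∀ φ ∈ l, φ.IsPi) : (conj l).IsPi := by
  induction l with
  | nil => simp [conj, IsPi]
  | cons φ l ih =>
    simp only [List.mem_cons, forall_eq_or_imp] at h
    have := ih h.2
    simp_all [conj, IsPi, cls]

/-- A disjunction of sharply bounded formulas is sharply bounded. [folklore] -/
theorem isSB_disj {l : List (SForm n)} (h : ∀ φ ∈ l, φ.IsSB) : (disj l).IsSB := by
  induction l with
  | nil => simp [disj, IsSB, cls]
  | cons φ l ih =>
    simp only [List.mem_cons, forall_eq_or_imp] at h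
    have := ih h.2
    simp_all [disj, IsSB, cls]

/-- A disjunction of `Σᵇ₁` formulas is `Σᵇ₁`. [folklore] -/
theorem isSig_disj {l : List (SForm n)} (h : ∀ φ ∈ l, φ.IsSig) : (disj l).IsSig := by
  induction l with
  | nil => simp [disj, IsSig, cls]
  | cons φ l ih =>
    simp only [List.mem_cons, forall_eq_or_imp] at h
    have := ih h.2
    simp_all [disj, IsSig, cls]

/-- A disjunction of `Πᵇ₁` formulas is `Πᵇ₁`. [folklore] -/
theorem isPi_disj {l : List (SForm n)} (h : ∀ φ ∈ l, φ.IsPi) : (disj l).IsPi := by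
  induction l with
  | nil => simp [disj, IsPi, cls]
  | cons φ l ih =>
    simp only [List.mem_cons, forall_eq_or_imp] at h
    have := ih h.2
    simp_all [disj, IsPi, cls]

end ClsLemmas

/-! ## Renaming variables and substituting terms -/

/-- Lift a renaming of named variables under one new (last) binder. [folklore] -/
def liftLast (g : Fin n → Fin m) : Fin (n + 1) → Fin (m + 1) :=
  Fin.lastCases (Fin.last m) fun j => Fin.castSucc (g j)

/-- Renaming of the named variables of a formula along `g : Fin n → Fin m` (in particular
weakening into a larger variable context) (Buss 1986, §2.1: the classes are closed under renaming
of variables). [cite: Buss1986, §2.1] -/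
def rel : {n m : ℕ} → (Fin n → Fin m) → SForm n → SForm m
  | _, _, g, le t s => le (t.relabel g) (s.relabel g)
  | _, _, g, eq t s => eq (t.relabel g) (s.relabel g)
  | _, _, _, fls => fls
  | _, _, g, imp φ ψ => imp (rel g φ) (rel g ψ)
  | _, _, g, and φ ψ => and (rel g φ) (rel g ψ)
  | _, _, g, or φ ψ => or (rel g φ) (rel g ψ)
  | _, _, g, bex t φ => bex (t.relabel g) (rel (liftLast g) φ)
  | _, _, g, ball t φ => ball (t.relabel g) (rel (liftLast g) φ)
  | _, _, g, bexLen t φ => bexLen (t.relabel g) (rel (liftLast g) φ)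
  | _, _, g, ballLen t φ => ballLen (t.relabel g) (rel (liftLast g) φ)

section Rel

variable {M : Type} [Language.boundedArith.Structure M]

omit [Language.boundedArith.Structure M] in
/-- Assignments commute with `liftLast`. [folklore] -/
theorem snoc_comp_liftLast (g : Fin n → Fin m) (v : Fin m → M) (a : M) :
    (Fin.snoc v a : Fin (m + 1) → M) ∘ liftLast g = Fin.snoc (v ∘ g) a := by
  funext j
  cases j using Fin.lastCases with
  | last => simp [liftLast]
  | cast j => simp [liftLast]

/-- **Semantics of renaming**: `(φ.rel g).Realize v ↔ φ.Realize (v ∘ g)`. [folklore] -/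
theorem realize_rel : ∀ {n m : ℕ} (g : Fin n → Fin m) (φ : SForm n) (v : Fin m → M),
    (rel g φ).Realize v ↔ φ.Realize (v ∘ g)
  | _, _, g, le t s, v => by simp [rel, Term.realize_relabel]
  | _, _, g, eq t s, v => by simp [rel, Term.realize_relabel]
  | _, _, _, fls, v => Iff.rfl
  | _, _, g, imp φ ψ, v => by
    simp only [rel, realize_imp, realize_rel g φ, realize_rel g ψ]
  | _, _, g, and φ ψ, v => by
    simp only [rel, realize_and, realize_rel g φ, realize_rel g ψ]
  | _, _, g, or φ ψ, v => by
    simp only [rel, realize_or, realize_rel g φ, realize_rel g ψ]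
  | _, _, g, bex t φ, v => by
    simp only [rel, realize_bex, Term.realize_relabel, realize_rel (liftLast g) φ,
      snoc_comp_liftLast]
  | _, _, g, ball t φ, v => by
    simp only [rel, realize_ball, Term.realize_relabel, realize_rel (liftLast g) φ,
      snoc_comp_liftLast]
  | _, _, g, bexLen t φ, v => by
    simp only [rel, realize_bexLen, Term.realize_relabel, realize_rel (liftLast g) φ,
      snoc_comp_liftLast]
  | _, _, g, ballLen t φ, v => by
    simp only [rel, realize_ballLen, Term.realize_relabel, realize_rel (liftLast g) φ,
      snoc_comp_liftLast]

omit [Language.boundedArith.Structure M] in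
/-- Renaming does not change the class. [folklore] -/
@[simp] theorem cls_rel : ∀ {n m : ℕ} (g : Fin n → Fin m) (φ : SForm n), cls (rel g φ) = cls φ
  | _, _, g, le t s => rfl
  | _, _, g, eq t s => rfl
  | _, _, _, fls => rfl
  | _, _, g, imp φ ψ => by simp only [rel, cls, cls_rel g φ, cls_rel g ψ]
  | _, _, g, and φ ψ => by simp only [rel, cls, cls_rel g φ, cls_rel g ψ]
  | _, _, g, or φ ψ => by simp only [rel, cls, cls_rel g φ, cls_rel g ψ]
  | _, _, g, bex t φ => by simp only [rel, cls, cls_rel (liftLast g) φ]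
  | _, _, g, ball t φ => by simp only [rel, cls, cls_rel (liftLast g) φ]
  | _, _, g, bexLen t φ => by simp only [rel, cls, cls_rel (liftLast g) φ]
  | _, _, g, ballLen t φ => by simp only [rel, cls, cls_rel (liftLast g) φ]

end Rel

/-- Lift a term substitution under one new (last) binder: the bound variable is kept, the
substituted terms are weakened. [folklore] -/
def liftSubst (σ : Fin n → Language.boundedArith.Term (Fin m)) :
    Fin (n + 1) → Language.boundedArith.Term (Fin (m + 1)) :=
  Fin.lastCases (Term.var (Fin.last m)) fun j => (σ j).relabel Fin.castSucc

/-- Substitution of terms for the named variables of a formula (Buss 1986, §2.1: the classes are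
closed under term substitution). [cite: Buss1986, §2.1] -/
def subst : {n m : ℕ} → (Fin n → Language.boundedArith.Term (Fin m)) → SForm n → SForm m
  | _, _, σ, le t s => le (t.subst σ) (s.subst σ)
  | _, _, σ, eq t s => eq (t.subst σ) (s.subst σ)
  | _, _, _, fls => fls
  | _, _, σ, imp φ ψ => imp (subst σ φ) (subst σ ψ)
  | _, _, σ, and φ ψ => and (subst σ φ) (subst σ ψ)
  | _, _, σ, or φ ψ => or (subst σ φ) (subst σ ψ)
  | _, _, σ, bex t φ => bex (t.subst σ) (subst (liftSubst σ) φ)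
  | _, _, σ, ball t φ => ball (t.subst σ) (subst (liftSubst σ) φ)
  | _, _, σ, bexLen t φ => bexLen (t.subst σ) (subst (liftSubst σ) φ)
  | _, _, σ, ballLen t φ => ballLen (t.subst σ) (subst (liftSubst σ) φ)

section Subst

variable {M : Type} [Language.boundedArith.Structure M]

/-- Assignments commute with `liftSubst`. [folklore] -/
theorem realize_liftSubst (σ : Fin n → Language.boundedArith.Term (Fin m)) (v : Fin m → M)
    (a : M) :
    (fun j => (liftSubst σ j).realize (Fin.snoc v a : Fin (m + 1) → M)) =
      Fin.snoc (fun j => (σ j).realize v) a := by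
  funext j
  cases j using Fin.lastCases with
  | last => simp [liftSubst]
  | cast j => simp [liftSubst, Term.realize_relabel, Function.comp_def]

/-- **Semantics of substitution**: `(φ.subst σ).Realize v ↔ φ.Realize (fun j => (σ j).realize v)`.
[folklore] -/
theorem realize_subst : ∀ {n m : ℕ} (σ : Fin n → Language.boundedArith.Term (Fin m))
    (φ : SForm n) (v : Fin m → M),
    (subst σ φ).Realize v ↔ φ.Realize fun j => (σ j).realize v
  | _, _, σ, le t s, v => by simp [subst, Term.realize_subst]
  | _, _, σ, eq t s, v => by simp [subst, Term.realize_subst]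
  | _, _, _, fls, v => Iff.rfl
  | _, _, σ, imp φ ψ, v => by
    simp only [subst, realize_imp, realize_subst σ φ, realize_subst σ ψ]
  | _, _, σ, and φ ψ, v => by
    simp only [subst, realize_and, realize_subst σ φ, realize_subst σ ψ]
  | _, _, σ, or φ ψ, v => by
    simp only [subst, realize_or, realize_subst σ φ, realize_subst σ ψ]
  | _, _, σ, bex t φ, v => by
    simp only [subst, realize_bex, Term.realize_subst, realize_subst (liftSubst σ) φ,
      realize_liftSubst]
  | _, _, σ, ball t φ, v => by
    simp only [subst, realize_ball, Term.realize_subst, realize_subst (liftSubst σ) φ,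
      realize_liftSubst]
  | _, _, σ, bexLen t φ, v => by
    simp only [subst, realize_bexLen, Term.realize_subst, realize_subst (liftSubst σ) φ,
      realize_liftSubst]
  | _, _, σ, ballLen t φ, v => by
    simp only [subst, realize_ballLen, Term.realize_subst, realize_subst (liftSubst σ) φ,
      realize_liftSubst]

omit [Language.boundedArith.Structure M] in
/-- Substitution does not change the class. [folklore] -/
@[simp] theorem cls_subst : ∀ {n m : ℕ} (σ : Fin n → Language.boundedArith.Term (Fin m))
    (φ : SForm n), cls (subst σ φ) = cls φ
  | _, _, σ, le t s => rfl
  | _, _, σ, eq t s => rfl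
  | _, _, _, fls => rfl
  | _, _, σ, imp φ ψ => by simp only [subst, cls, cls_subst σ φ, cls_subst σ ψ]
  | _, _, σ, and φ ψ => by simp only [subst, cls, cls_subst σ φ, cls_subst σ ψ]
  | _, _, σ, or φ ψ => by simp only [subst, cls, cls_subst σ φ, cls_subst σ ψ]
  | _, _, σ, bex t φ => by simp only [subst, cls, cls_subst (liftSubst σ) φ]
  | _, _, σ, ball t φ => by simp only [subst, cls, cls_subst (liftSubst σ) φ]
  | _, _, σ, bexLen t φ => by simp only [subst, cls, cls_subst (liftSubst σ) φ]
  | _, _, σ, ballLen t φ => by simp only [subst, cls, cls_subst (liftSubst σ) φ]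

end Subst

/-! ## Definability with parameters in a fixed structure -/

section Parameters

variable {M : Type} [Language.boundedArith.Structure M]

/-- **A `Σᵇ₁` `SForm` defines a `Σᵇ₁`-definable predicate with parameters**: assigning to each
named variable either a parameter `a ∈ M` (`Sum.inl a`) or an argument position (`Sum.inr j`),
the predicate `xs ↦ φ.Realize (argEnv xs ∘ g)` is `IsSigmabDef 1` in the sense of
`BoundedArithDefinability.lean`, so that `Σᵇ₁-PIND`/`LIND` of `S₂¹` apply to it
(Buss 1986, §2.1: formulas with parameters). [cite: Buss1986, §2.1] -/
theorem isSigmabDef {φ : SForm n} (h : φ.IsSig) (g : Fin n → M ⊕ Fin m) :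
    IsSigmabDef 1 fun xs : Fin m → M => φ.Realize (argEnv xs ∘ g) :=
  ⟨φ.toFormula.relabel g, (isSigmab_toFormula h).formulaRelabel g, fun xs => by
    rw [Formula.realize_relabel, realize_toFormula]⟩

/-- A `Πᵇ₁` `SForm` defines a `Πᵇ₁`-definable predicate with parameters (Buss 1986, §2.1).
[cite: Buss1986, §2.1] -/
theorem isPibDef {φ : SForm n} (h : φ.IsPi) (g : Fin n → M ⊕ Fin m) :
    IsPibDef 1 fun xs : Fin m → M => φ.Realize (argEnv xs ∘ g) :=
  ⟨φ.toFormula.relabel g, (isPib_toFormula h).formulaRelabel g, fun xs => by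
    rw [Formula.realize_relabel, realize_toFormula]⟩

/-- A sharply bounded `SForm` defines a `Σᵇ₀`-definable predicate with parameters (to which
`Σᵇ₀-IND` applies) (Buss 1986, §2.1). [cite: Buss1986, §2.1] -/
theorem isSigmabDef_zero {φ : SForm n} (h : φ.IsSB) (g : Fin n → M ⊕ Fin m) :
    IsSigmabDef 0 fun xs : Fin m → M => φ.Realize (argEnv xs ∘ g) :=
  ⟨φ.toFormula.relabel g, (IsSigmab.of_isSharplyBounded (isSharplyBounded_toFormula h)).formulaRelabel g,
    fun xs => by rw [Formula.realize_relabel, realize_toFormula]⟩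

/-- A `Δᵇ₁` pair of `SForm`s (a `Σᵇ₁` and a `Πᵇ₁` form with the same meaning) defines a
`Δᵇ₁`-definable predicate with parameters (Buss 1986, §2.2). [cite: Buss1986, §2.2] -/
theorem isDeltabDef {φ ψ : SForm n} (hφ : φ.IsSig) (hψ : ψ.IsPi)
    (hiff : ∀ v : Fin n → M, φ.Realize v ↔ ψ.Realize v) (g : Fin n → M ⊕ Fin m) :
    IsDeltabDef 1 fun xs : Fin m → M => φ.Realize (argEnv xs ∘ g) :=
  ⟨isSigmabDef hφ g, (isPibDef hψ g).of_iff fun _ => (hiff _).symm⟩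

/-- The unary case: a `Σᵇ₁` `SForm` in variables `Fin (k + 1)`, at parameters `p ∈ Mᵏ` for the
first `k` variables, defines a `Σᵇ₁`-definable unary predicate of its last variable (the shape
used by `IsSigmabDef.pinduction'`, `BASICModel.lind_of_pind`). [cite: Buss1986, §2.1] -/
theorem isSigmabDef_snoc {k : ℕ} {φ : SForm (k + 1)} (h : φ.IsSig) (p : Fin k → M) :
    IsSigmabDef 1 fun v : Fin 1 → M => φ.Realize (Fin.snoc p (v 0)) := by
  refine (isSigmabDef h (Fin.lastCases (Sum.inr 0) fun j => Sum.inl (p j))).of_iff fun xs => ?_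
  refine Iff.of_eq (congrArg _ ?_)
  funext j
  cases j using Fin.lastCases with
  | last => simp
  | cast j => simp

/-- The unary case for `Πᵇ₁`. [cite: Buss1986, §2.1] -/
theorem isPibDef_snoc {k : ℕ} {φ : SForm (k + 1)} (h : φ.IsPi) (p : Fin k → M) :
    IsPibDef 1 fun v : Fin 1 → M => φ.Realize (Fin.snoc p (v 0)) := by
  refine (isPibDef h (Fin.lastCases (Sum.inr 0) fun j => Sum.inl (p j))).of_iff fun xs => ?_
  refine Iff.of_eq (congrArg _ ?_)
  funext j
  cases j using Fin.lastCases with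
  | last => simp
  | cast j => simp

/-- The unary case for sharply bounded formulas (`Σᵇ₀`). [cite: Buss1986, §2.1] -/
theorem isSigmabDef_zero_snoc {k : ℕ} {φ : SForm (k + 1)} (h : φ.IsSB) (p : Fin k → M) :
    IsSigmabDef 0 fun v : Fin 1 → M => φ.Realize (Fin.snoc p (v 0)) := by
  refine (isSigmabDef_zero h (Fin.lastCases (Sum.inr 0) fun j => Sum.inl (p j))).of_iff
    fun xs => ?_
  refine Iff.of_eq (congrArg _ ?_)
  funext j
  cases j using Fin.lastCases with
  | last => simp
  | cast j => simp

end Parameters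

end SForm

end Literature.Computability.MetaComplexity
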